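import Summits.QuantumFields.YangMills.Theorems.LangevinControlUVFemtoCurvatureTwoPointCDoublingPlaquette
import Literature.Analysis.Calculus.SmoothAlongExp
import HarnessLib

/-!
# Crux `FemtoCurvatureTwoPointC` (stmt-QuantumFields-16204), line `Sketch`, v7 — stub `stub_sliceOpen`

Route `LangevinControlUV` of `QuantumFields/YangMills`. In the local conical package behind `stub_sublevelDoubling`
(vocabulary `…CDoublingDefs`: `Fib`, `SiteFun`, `OneForm`, `dZero`, `zeroModes`, `slice`, `cfg`, `gaugeExp`) the lead
parametrises the configurations near `τ` as `gaugeExp η · cfg τ A`: a gauge transformation generated by a site function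
`η ⟂ zeroModes τ` applied to the exponential chart point over a 1-form `A` in the gauge slice `slice τ = (range d⁰)ᗮ`.
This file proves that the parametrisation COVERS a neighbourhood of `τ` with small parameters (`stub_sliceOpen`):
for every `δ > 0` there is an open `O ∋ τ` all of whose points are `gaugeExp η · cfg τ A` with `η ∈ (zeroModes τ)ᗮ`,
`A ∈ slice τ`, `‖η‖, ‖A‖ < δ`.

Proof (inverse function theorem in log-coordinates). With `M = lieIso r.ρ`, a continuous linear left inverse `Q` of `M`
and the local logarithm `localLog` of `Literature/Analysis/Calculus/SmoothAlongExp`, put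
`Γ(η, A)(e) = Q (localLog (ρ((gaugeExp η · cfg τ A) e) ρ(τ e)⁻¹))`. Edge by edge
`ρ((gaugeExp η · cfg τ A)(x,i)) ρ(τ(x,i))⁻¹ = e^{M η(x)} e^{M A(x,i)} ρ(τ(x,i)) e^{−M η(x+eᵢ)} ρ(τ(x,i))⁻¹` (`rho_param_mul`),
whose strict derivative at `0` is `M (d⁰η̇ + Ȧ)(x,i)` (`hasStrictFDerivAt_rhoParam`); hence `Γ` has strict derivative
`(η̇, Ȧ) ↦ d⁰η̇ + Ȧ` on `(zeroModes τ)ᗮ × slice τ` (`hasStrictFDerivAt_logParam`), which is ONTO the 1-forms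
(`exists_dZero_add_eq`: `Ω = d⁰η₀ + (Ω − proj Ω)` and zero modes lie in `ker d⁰`). By
`HasStrictFDerivAt.map_nhds_eq_of_surj`, `Γ` maps neighbourhoods of `0` onto neighbourhoods of `0`. Finally log-coordinates
separate points of `ρ(G)` near `1` (`exists_logChart_radius`: von Neumann's `exists_chart_radius` and `localLog ∘ exp = id`
near `0`), so equality of the log-coordinates of `U` near `τ` and of `gaugeExp η · cfg τ A` gives `U = gaugeExp η · cfg τ A`.
The derivatives are packaged as `∃ Φ', HasStrictFDerivAt … Φ' 0 ∧ ∀ q, Φ' q = …` (no continuous-linear-map constructors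
on the `L²` parameter spaces in statements). References: inverse function theorem (Mathlib); J. von Neumann (1929) /
Hall (2015), Cor. 3.44 for the chart.
-/

set_option autoImplicit false

noncomputable section

open scoped Matrix Matrix.Norms.Frobenius InnerProductSpace Topology ContDiff
open NormedSpace Filter Set
open Literature.MathematicalPhysics.QuantumLattice Literature.MathematicalPhysics.QuantumFieldTheory
open Summit.QuantumFields.YangMills.Theorems.FreeEnergyLogCoefficient
open Literature.Analysis.Calculus (localLog localLog_one contDiffAt_localLog hasStrictFDerivAt_exp_zero_equiv)

namespace Summit.QuantumFields.YangMills.Theorems.FemtoCurvatureTwoPointC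

namespace SliceOpen

open Doubling

/-! ### The local logarithm and products of exponentials -/

section LocalLog

variable {𝔸 : Type*} [NormedRing 𝔸] [NormedAlgebra ℝ 𝔸] [CompleteSpace 𝔸]

/-- `localLog` (the inverse-function-theorem inverse of `exp` at `0`) has strict derivative `id` at `1`. -/
theorem hasStrictFDerivAt_localLog_one :
    HasStrictFDerivAt (localLog : 𝔸 → 𝔸) (ContinuousLinearMap.id ℝ 𝔸) 1 := by
  have h := ((Literature.Analysis.Calculus.contDiffAt_exp (m := ω) (0 : 𝔸)).hasStrictFDerivAt'
    hasStrictFDerivAt_exp_zero_equiv.hasFDerivAt (by simp)).to_localInverse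
  rw [exp_zero] at h
  refine h.congr_fderiv ?_
  ext v
  simp

/-- `localLog (exp X) = X` for `X` near `0`. -/
theorem eventually_localLog_exp : ∀ᶠ X in 𝓝 (0 : 𝔸), localLog (exp X) = X :=
  ((Literature.Analysis.Calculus.contDiffAt_exp (m := ω) (0 : 𝔸)).hasStrictFDerivAt'
    hasStrictFDerivAt_exp_zero_equiv.hasFDerivAt (by simp)).eventually_left_inverse

/-- Strict derivative at `0` of `p ↦ e^{a p} e^{b p} T e^{-c p} S` for continuous linear `a, b, c` and `T S = 1`:
a continuous linear `D` with `D v = a v + b v - T (c v) S`. -/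
theorem hasStrictFDerivAt_expProd {E : Type*} [NormedAddCommGroup E] [NormedSpace ℝ E] (a b c : E →L[ℝ] 𝔸)
    (T S : 𝔸) (hTS : T * S = 1) :
    ∃ D : E →L[ℝ] 𝔸, HasStrictFDerivAt (fun p => exp (a p) * exp (b p) * T * exp (-c p) * S) D 0 ∧
      ∀ v, D v = a v + b v - T * c v * S := by
  have hE : ∀ ℓ : E →L[ℝ] 𝔸, HasStrictFDerivAt (fun p => exp (ℓ p)) ((1 : 𝔸 →L[ℝ] 𝔸).comp ℓ) 0 := by
    intro ℓ
    have h : HasStrictFDerivAt (exp : 𝔸 → 𝔸) (1 : 𝔸 →L[ℝ] 𝔸) (ℓ 0) := by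
      rw [map_zero]; exact hasStrictFDerivAt_exp_zero
    exact h.comp 0 ℓ.hasStrictFDerivAt
  have h := ((((hE a).mul' (hE b)).mul_const' T).mul' (hE (-c))).mul_const' S
  refine ⟨_, h, fun v => ?_⟩
  simp only [smul_apply, add_apply, neg_apply, ContinuousLinearMap.comp_apply, one_apply_eq_self,
    Pi.mul_apply, map_zero, exp_zero, one_smul, op_smul_eq_mul, smul_eq_mul, one_mul, mul_one, add_mul,
    mul_assoc, hTS, neg_mul, mul_neg]
  abel

end LocalLog

/-! ### Log-coordinates on `ρ(G)` near `1` -/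

variable {G : Type} [Group G] [TopologicalSpace G] (r : LatticeRep G)

/-- A continuous linear left inverse `Q` of the isometry `M = lieIso r.ρ : ℝ^D → M_N(ℂ)`: `Q (M a) = a`. -/
theorem exists_leftInverse_lieIso :
    ∃ Q : Matrix (Fin r.N) (Fin r.N) ℂ →L[ℝ] Fib r, ∀ a, Q (lieIso r.ρ a) = a := by
  obtain ⟨g, hg⟩ := (lieIso r.ρ).toLinearMap.exists_leftInverse_of_injective
    (LinearMap.ker_eq_bot.2 (lieIso r.ρ).injective)
  exact ⟨LinearMap.toContinuousLinearMap g, fun a => by simpa using LinearMap.congr_fun hg a⟩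

variable [CompactSpace G]

/-- **Log-coordinates near `1`.** For a left inverse `Q` of `lieIso r.ρ` there is `r₁ > 0` such that every `g` with
`‖ρ g − 1‖ < r₁` is a chart point `expChart a` whose coordinate is read off by the logarithm: `Q (localLog (ρ g)) = a`
(von Neumann's local surjectivity of the chart, and `localLog ∘ exp = id` near `0`). In particular `g ↦ Q (localLog (ρ g))`
is injective on `{‖ρ g − 1‖ < r₁}`. -/
theorem exists_logChart_radius (Q : Matrix (Fin r.N) (Fin r.N) ℂ →L[ℝ] Fib r) (hQ : ∀ a, Q (lieIso r.ρ a) = a) :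
    ∃ r₁ : ℝ, 0 < r₁ ∧ ∀ g : G, ‖r.ρ g - 1‖ < r₁ →
      ∃ a : Fib r, expChart r.ρ a = g ∧ Q (localLog (r.ρ g)) = a := by
  obtain ⟨r₀, hr₀, h₀⟩ := exists_chart_radius r.ρ r.continuous r.injective r.mem_unitary
  obtain ⟨s, hs, hlog⟩ :=
    Metric.eventually_nhds_iff.1 (eventually_localLog_exp (𝔸 := Matrix (Fin r.N) (Fin r.N) ℂ))
  refine ⟨min r₀ (s / 2), lt_min hr₀ (half_pos hs), fun g hg => ?_⟩
  obtain ⟨a, hag, han⟩ := h₀ g (lt_of_lt_of_le hg (min_le_left _ _))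
  refine ⟨a, hag, ?_⟩
  have hs' : ‖lieIso r.ρ a‖ < s := by
    rw [norm_lieIso]
    have := lt_of_lt_of_le hg (min_le_right _ _)
    linarith
  have h2 : localLog (exp (lieIso r.ρ a)) = lieIso r.ρ a := hlog (by rwa [dist_zero_right])
  rw [← hag, rho_expChart r.ρ r.continuous, h2, hQ]

variable {L : ℕ}

/-- **The parametrisation in matrices**: `ρ((gaugeExp η · cfg τ A)(x,i)) ρ(τ(x,i))⁻¹ =
e^{M η(x)} e^{M A(x,i)} ρ(τ(x,i)) e^{−M η(x+eᵢ)} ρ(τ(x,i))⁻¹`. -/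
theorem rho_param_mul (τ : GaugeConfig 4 L G) (η : SiteFun r L) (A : OneForm r L) (x : Site 4 L) (i : Fin 4) :
    r.ρ (gaugeTransform (gaugeExp r η) (cfg r τ A) (x, i)) * r.ρ (τ (x, i))⁻¹ =
      exp (lieIso r.ρ (η x)) * exp (lieIso r.ρ (A (x, i))) * r.ρ (τ (x, i)) *
        exp (-lieIso r.ρ (η (x.shift i))) * r.ρ (τ (x, i))⁻¹ := by
  rw [rho_gaugeTransform_cfg]
  simp only [gaugeExp, rho_expChart r.ρ r.continuous, rho_expChart_inv]

/-- At the zero parameters the matrix `ρ((gaugeExp 0 · cfg τ 0) e) ρ(τ e)⁻¹` is `1`. -/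
theorem rho_param_zero (τ : GaugeConfig 4 L G) (e : Edge 4 L) :
    r.ρ (gaugeTransform (gaugeExp r (0 : SiteFun r L)) (cfg r τ (0 : OneForm r L)) e) * r.ρ (τ e)⁻¹ = 1 := by
  obtain ⟨x, i⟩ := e
  rw [rho_param_mul]
  simp [rho_mul_inv]

/-- Zero modes are killed by the linearised gauge action: `d⁰ζ = 0` for `ζ ∈ zeroModes τ`. -/
theorem dZero_eq_zero_of_mem_zeroModes (τ : GaugeConfig 4 L G) {ζ : SiteFun r L} (hζ : ζ ∈ zeroModes r τ) :
    dZero r τ ζ = 0 := by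
  refine PiLp.ext fun e => ?_
  obtain ⟨x, i⟩ := e
  have h := (mem_zeroModes_iff r τ ζ).1 hζ i
  have hx : adFib r (τ (x, i)) (ζ (x.shift i)) = ζ x := by
    simpa using congrArg (fun f : SiteFun r L => f x) h
  rw [dZero_apply, hx, sub_self, PiLp.zero_apply]

section L2

variable [NeZero L]

/-- **Strict derivative of the parametrisation at `0`** (matrix form): on `(zeroModes τ)ᗮ × slice τ` the map
`(η, A) ↦ ρ((gaugeExp η · cfg τ A) e) ρ(τ e)⁻¹` has a strict derivative `Φ'` at `0` with `Φ' (η̇, Ȧ) = M ((d⁰η̇ + Ȧ) e)`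
(product rule for `e^{M η(x)} e^{M A(e)} T e^{−M η(x+eᵢ)} T⁻¹` and `T (M a) T⁻¹ = M (Ad_T a)`). -/
theorem hasStrictFDerivAt_rhoParam (τ : GaugeConfig 4 L G) (e : Edge 4 L) :
    ∃ Φ' : ↥(zeroModes r τ)ᗮ × ↥(slice r τ) →L[ℝ] Matrix (Fin r.N) (Fin r.N) ℂ,
      HasStrictFDerivAt
        (fun q : ↥(zeroModes r τ)ᗮ × ↥(slice r τ) =>
          r.ρ (gaugeTransform (gaugeExp r (q.1 : SiteFun r L)) (cfg r τ (q.2 : OneForm r L)) e) * r.ρ (τ e)⁻¹) Φ' 0 ∧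
      ∀ q, Φ' q = lieIso r.ρ (dZero r τ (q.1 : SiteFun r L) e + (q.2 : OneForm r L) e) := by
  obtain ⟨x, i⟩ := e
  -- the three linear maps `q ↦ M η(x)`, `q ↦ M A(x,i)`, `q ↦ M η(x+eᵢ)` on `(zeroModes τ)ᗮ × slice τ`
  let ι₁ : ↥(zeroModes r τ)ᗮ × ↥(slice r τ) →L[ℝ] SiteFun r L :=
    (zeroModes r τ)ᗮ.subtypeL.comp (ContinuousLinearMap.fst ℝ _ _)
  let ι₂ : ↥(zeroModes r τ)ᗮ × ↥(slice r τ) →L[ℝ] OneForm r L :=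
    (slice r τ).subtypeL.comp (ContinuousLinearMap.snd ℝ _ _)
  let a := (lieIso r.ρ).toContinuousLinearMap.comp ((PiLp.proj 2 (fun _ : Site 4 L => Fib r) x).comp ι₁)
  let b := (lieIso r.ρ).toContinuousLinearMap.comp ((PiLp.proj 2 (fun _ : Edge 4 L => Fib r) (x, i)).comp ι₂)
  let c := (lieIso r.ρ).toContinuousLinearMap.comp ((PiLp.proj 2 (fun _ : Site 4 L => Fib r) (x.shift i)).comp ι₁)
  obtain ⟨D, hD, hDv⟩ := hasStrictFDerivAt_expProd a b c _ _ (rho_mul_inv r (τ (x, i)))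
  have h : HasStrictFDerivAt (fun q : ↥(zeroModes r τ)ᗮ × ↥(slice r τ) =>
      r.ρ (gaugeTransform (gaugeExp r (q.1 : SiteFun r L)) (cfg r τ (q.2 : OneForm r L)) (x, i)) * r.ρ (τ (x, i))⁻¹)
      D 0 :=
    hD.congr_of_eventuallyEq (Eventually.of_forall fun q => (rho_param_mul r τ _ _ x i).symm)
  refine ⟨D, h, fun q => (hDv q).trans ?_⟩
  show lieIso r.ρ ((q.1 : SiteFun r L) x) + lieIso r.ρ ((q.2 : OneForm r L) (x, i)) -
      r.ρ (τ (x, i)) * lieIso r.ρ ((q.1 : SiteFun r L) (x.shift i)) * r.ρ (τ (x, i))⁻¹ =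
    lieIso r.ρ (dZero r τ (q.1 : SiteFun r L) (x, i) + (q.2 : OneForm r L) (x, i))
  rw [map_add, dZero_apply, map_sub, lieIso_adFib]
  abel

/-- **Continuity of the parametrisation** (matrix form): `(η, A) ↦ ρ((gaugeExp η · cfg τ A) e) ρ(τ e)⁻¹` is continuous on
`(zeroModes τ)ᗮ × slice τ` (a product of exponentials of continuous linear maps). -/
theorem continuous_rhoParam (τ : GaugeConfig 4 L G) (e : Edge 4 L) :
    Continuous fun q : ↥(zeroModes r τ)ᗮ × ↥(slice r τ) =>
      r.ρ (gaugeTransform (gaugeExp r (q.1 : SiteFun r L)) (cfg r τ (q.2 : OneForm r L)) e) * r.ρ (τ e)⁻¹ := by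
  obtain ⟨x, i⟩ := e
  simp only [rho_param_mul]
  have h₁ : Continuous fun q : ↥(zeroModes r τ)ᗮ × ↥(slice r τ) => (q.1 : SiteFun r L) :=
    continuous_subtype_val.comp continuous_fst
  have h₂ : Continuous fun q : ↥(zeroModes r τ)ᗮ × ↥(slice r τ) => (q.2 : OneForm r L) :=
    continuous_subtype_val.comp continuous_snd
  have ha : Continuous fun q : ↥(zeroModes r τ)ᗮ × ↥(slice r τ) => lieIso r.ρ ((q.1 : SiteFun r L) x) :=
    (lieIso r.ρ).continuous.comp ((PiLp.continuous_apply 2 _ x).comp h₁)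
  have hb : Continuous fun q : ↥(zeroModes r τ)ᗮ × ↥(slice r τ) => lieIso r.ρ ((q.2 : OneForm r L) (x, i)) :=
    (lieIso r.ρ).continuous.comp ((PiLp.continuous_apply 2 _ (x, i)).comp h₂)
  have hc : Continuous fun q : ↥(zeroModes r τ)ᗮ × ↥(slice r τ) => -lieIso r.ρ ((q.1 : SiteFun r L) (x.shift i)) :=
    ((lieIso r.ρ).continuous.comp ((PiLp.continuous_apply 2 _ (x.shift i)).comp h₁)).neg
  exact ((((exp_continuous.comp ha).mul (exp_continuous.comp hb)).mul continuous_const).mul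
    (exp_continuous.comp hc)).mul continuous_const

/-- **Strict derivative of the log-coordinates of the parametrisation at `0`**: for a left inverse `Q` of `M`, the
`e`-component `(η, A) ↦ Q (localLog (ρ((gaugeExp η · cfg τ A) e) ρ(τ e)⁻¹))` has a strict derivative `Γ'` at `0` on
`(zeroModes τ)ᗮ × slice τ` with `Γ' (η̇, Ȧ) = (d⁰η̇ + Ȧ) e`. -/
theorem hasStrictFDerivAt_logParam (τ : GaugeConfig 4 L G) (Q : Matrix (Fin r.N) (Fin r.N) ℂ →L[ℝ] Fib r)
    (hQ : ∀ a, Q (lieIso r.ρ a) = a) (e : Edge 4 L) :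
    ∃ Γ' : ↥(zeroModes r τ)ᗮ × ↥(slice r τ) →L[ℝ] Fib r,
      HasStrictFDerivAt
        (fun q : ↥(zeroModes r τ)ᗮ × ↥(slice r τ) =>
          Q (localLog (r.ρ (gaugeTransform (gaugeExp r (q.1 : SiteFun r L)) (cfg r τ (q.2 : OneForm r L)) e) *
            r.ρ (τ e)⁻¹))) Γ' 0 ∧
      ∀ q, Γ' q = dZero r τ (q.1 : SiteFun r L) e + (q.2 : OneForm r L) e := by
  obtain ⟨Φ', h1, hΦ'⟩ := hasStrictFDerivAt_rhoParam r τ e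
  have h0 : r.ρ (gaugeTransform (gaugeExp r ((0 : ↥(zeroModes r τ)ᗮ × ↥(slice r τ)).1 : SiteFun r L))
      (cfg r τ ((0 : ↥(zeroModes r τ)ᗮ × ↥(slice r τ)).2 : OneForm r L)) e) * r.ρ (τ e)⁻¹ = 1 := by
    simp only [Prod.fst_zero, Prod.snd_zero, ZeroMemClass.coe_zero]
    exact rho_param_zero r τ e
  have h2 : HasStrictFDerivAt (localLog : Matrix (Fin r.N) (Fin r.N) ℂ → Matrix (Fin r.N) (Fin r.N) ℂ)
      (ContinuousLinearMap.id ℝ _)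
      (r.ρ (gaugeTransform (gaugeExp r ((0 : ↥(zeroModes r τ)ᗮ × ↥(slice r τ)).1 : SiteFun r L))
        (cfg r τ ((0 : ↥(zeroModes r τ)ᗮ × ↥(slice r τ)).2 : OneForm r L)) e) * r.ρ (τ e)⁻¹) := by
    rw [h0]; exact hasStrictFDerivAt_localLog_one
  have h3 := Q.hasStrictFDerivAt.comp (0 : ↥(zeroModes r τ)ᗮ × ↥(slice r τ))
    (h2.comp (0 : ↥(zeroModes r τ)ᗮ × ↥(slice r τ)) h1)
  exact ⟨_, h3, fun q => (congrArg Q (hΦ' q)).trans (hQ _)⟩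

/-- **The linearised parametrisation is onto**: every 1-form is `d⁰η + A` with `η ⟂ zeroModes τ` and `A ∈ slice τ`
(orthogonal decomposition along `range d⁰`, then along `zeroModes τ ⊆ ker d⁰`). -/
theorem exists_dZero_add_eq (τ : GaugeConfig 4 L G) (Ω : OneForm r L) :
    ∃ η ∈ (zeroModes r τ)ᗮ, ∃ A ∈ slice r τ, dZero r τ η + A = Ω := by
  obtain ⟨y, hy, z, hz, hΩ⟩ :=
    Submodule.exists_add_mem_mem_orthogonal (K := LinearMap.range (dZero r τ)) Ω
  obtain ⟨η₀, rfl⟩ := LinearMap.mem_range.1 hy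
  obtain ⟨ζ, hζ, η, hη, hη₀⟩ := Submodule.exists_add_mem_mem_orthogonal (K := zeroModes r τ) η₀
  refine ⟨η, hη, z, hz, ?_⟩
  rw [hΩ, hη₀, map_add, dZero_eq_zero_of_mem_zeroModes r τ hζ, zero_add]

end L2

end SliceOpen

open SliceOpen Doubling in
/-- **The gauge-slice parametrisation covers a neighbourhood of `τ` (stub `stub_sliceOpen`).** For every `δ > 0` there
is an open `O ∋ τ` in `G^E` such that every `U ∈ O` is `gaugeExp η · cfg τ A` with `η ∈ (zeroModes τ)ᗮ`, `A ∈ slice τ`,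
`‖η‖ < δ`, `‖A‖ < δ`. Inverse function theorem for the log-coordinates `Γ` of the parametrisation (strict derivative
`(η̇, Ȧ) ↦ d⁰η̇ + Ȧ`, onto), plus separation of points of `ρ(G)` near `1` by log-coordinates. -/
theorem stub_sliceOpen : ∀ {G : Type} [Group G] [TopologicalSpace G] [CompactSpace G] (r : LatticeRep G) {L : ℕ} [NeZero L] (τ : GaugeConfig 4 L G) (δ : ℝ), 0 < δ → ∃ O : Set (GaugeConfig 4 L G), IsOpen O ∧ τ ∈ O ∧ ∀ U ∈ O, ∃ (η : Summit.QuantumFields.YangMills.Theorems.FemtoCurvatureTwoPointC.Doubling.SiteFun r L) (A : Summit.QuantumFields.YangMills.Theorems.FemtoCurvatureTwoPointC.Doubling.OneForm r L), η ∈ (Summit.QuantumFields.YangMills.Theorems.FemtoCurvatureTwoPointC.Doubling.zeroModes r τ)ᗮ ∧ A ∈ Summit.QuantumFields.YangMills.Theorems.FemtoCurvatureTwoPointC.Doubling.slice r τ ∧ ‖η‖ < δ ∧ ‖A‖ < δ ∧ U = gaugeTransform (Summit.QuantumFields.YangMills.Theorems.FemtoCurvatureTwoPointC.Doubling.gaugeExp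 r η) (Summit.QuantumFields.YangMills.Theorems.FemtoCurvatureTwoPointC.Doubling.cfg r τ A) := by
  intro G _ _ _ r L _ τ δ hδ
  obtain ⟨Q, hQ⟩ := exists_leftInverse_lieIso r
  obtain ⟨r₁, hr₁, hchart⟩ := exists_logChart_radius r Q hQ
  -- the parametrisation in matrices and its log-coordinates
  set Φ : ↥(zeroModes r τ)ᗮ × ↥(slice r τ) → Edge 4 L → Matrix (Fin r.N) (Fin r.N) ℂ := fun q e =>
    r.ρ (gaugeTransform (gaugeExp r (q.1 : SiteFun r L)) (cfg r τ (q.2 : OneForm r L)) e) * r.ρ (τ e)⁻¹ with hΦ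
  set Γ : ↥(zeroModes r τ)ᗮ × ↥(slice r τ) → Edge 4 L → Fib r := fun q e => Q (localLog (Φ q e)) with hΓ
  -- strict derivative of `Γ` at `0`, onto
  choose Γ' hΓ' hΓ'q using fun e => hasStrictFDerivAt_logParam r τ Q hQ e
  have hΓd : HasStrictFDerivAt Γ (ContinuousLinearMap.pi Γ') 0 := hasStrictFDerivAt_pi.2 hΓ'
  have hmap : map Γ (𝓝 0) = 𝓝 (Γ 0) := by
    refine hΓd.map_nhds_eq_of_surj (LinearMap.range_eq_top.2 fun Ω => ?_)
    obtain ⟨η, hη, A, hA, hΩ⟩ := exists_dZero_add_eq r τ (WithLp.toLp 2 Ω)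
    refine ⟨(⟨η, hη⟩, ⟨A, hA⟩), funext fun e => ?_⟩
    have h := congrArg (fun B : OneForm r L => B e) hΩ
    simp only [PiLp.add_apply] at h
    simpa [hΓ'q] using h
  have hΦ0 : ∀ e, Φ 0 e = 1 := fun e => by
    simp only [hΦ, Prod.fst_zero, Prod.snd_zero, ZeroMemClass.coe_zero]
    exact rho_param_zero r τ e
  have hΓ0 : Γ 0 = 0 := funext fun e => by
    simp only [hΓ, hΦ0, localLog_one, map_zero, Pi.zero_apply]
  -- the good parameter set and its image, a neighbourhood of `0`
  set S : Set (↥(zeroModes r τ)ᗮ × ↥(slice r τ)) := Metric.ball 0 δ ∩ {q | ∀ e, ‖Φ q e - 1‖ < r₁} with hS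
  have hSn : S ∈ 𝓝 (0 : ↥(zeroModes r τ)ᗮ × ↥(slice r τ)) := by
    refine inter_mem (Metric.ball_mem_nhds _ hδ) (eventually_all.2 fun e => ?_)
    have hc : ContinuousAt (fun q : ↥(zeroModes r τ)ᗮ × ↥(slice r τ) => Φ q e) 0 := by
      simp only [hΦ]; exact (continuous_rhoParam r τ e).continuousAt
    have hb : Metric.ball (1 : Matrix (Fin r.N) (Fin r.N) ℂ) r₁ ∈ 𝓝 (Φ 0 e) := by
      rw [hΦ0]; exact Metric.ball_mem_nhds _ hr₁
    filter_upwards [hc.preimage_mem_nhds hb] with q hq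
    rwa [mem_preimage, Metric.mem_ball, dist_eq_norm] at hq
  have himg : Γ '' S ∈ 𝓝 (0 : Edge 4 L → Fib r) := by
    rw [← hΓ0, ← hmap]; exact image_mem_map hSn
  -- log-coordinates of a configuration near `τ`
  set Λ : GaugeConfig 4 L G → Edge 4 L → Fib r := fun U e => Q (localLog (r.ρ (U e) * r.ρ (τ e)⁻¹)) with hΛ
  have hcU : ∀ e, Continuous fun U : GaugeConfig 4 L G => r.ρ (U e) * r.ρ (τ e)⁻¹ := fun e =>
    (r.continuous.comp (continuous_apply e)).mul continuous_const
  have hΛc : ContinuousAt Λ τ := by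
    refine continuousAt_pi.2 fun e => ?_
    have h2 : ContinuousAt (localLog : Matrix (Fin r.N) (Fin r.N) ℂ → Matrix (Fin r.N) (Fin r.N) ℂ)
        (r.ρ (τ e) * r.ρ (τ e)⁻¹) := by
      rw [rho_mul_inv]; exact (contDiffAt_localLog (m := 0)).continuousAt
    exact Q.continuous.continuousAt.comp
      (ContinuousAt.comp (f := fun U : GaugeConfig 4 L G => r.ρ (U e) * r.ρ (τ e)⁻¹) (x := τ) h2
        (hcU e).continuousAt)
  have hΛτ : Λ τ = 0 := funext fun e => by
    simp only [hΛ, rho_mul_inv, localLog_one, map_zero, Pi.zero_apply]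
  have hO₀ : Λ ⁻¹' (Γ '' S) ∈ 𝓝 τ := hΛc.preimage_mem_nhds (by rwa [hΛτ])
  have hO₁ : {U : GaugeConfig 4 L G | ∀ e, ‖r.ρ (U e) * r.ρ (τ e)⁻¹ - 1‖ < r₁} ∈ 𝓝 τ := by
    refine eventually_all.2 fun e => ?_
    have hb : Metric.ball (1 : Matrix (Fin r.N) (Fin r.N) ℂ) r₁ ∈ 𝓝 (r.ρ (τ e) * r.ρ (τ e)⁻¹) := by
      rw [rho_mul_inv]; exact Metric.ball_mem_nhds _ hr₁
    filter_upwards [((hcU e).continuousAt (x := τ)).preimage_mem_nhds hb] with U hU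
    rwa [mem_preimage, Metric.mem_ball, dist_eq_norm] at hU
  refine ⟨interior (Λ ⁻¹' (Γ '' S) ∩ {U | ∀ e, ‖r.ρ (U e) * r.ρ (τ e)⁻¹ - 1‖ < r₁}), isOpen_interior,
    mem_interior_iff_mem_nhds.2 (inter_mem hO₀ hO₁), fun U hU => ?_⟩
  obtain ⟨⟨q, ⟨hqδ, hq₁⟩, hqU⟩, hU₁⟩ := interior_subset hU
  simp only [hΦ, mem_setOf_eq] at hq₁
  refine ⟨(q.1 : SiteFun r L), (q.2 : OneForm r L), q.1.2, q.2.2,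
    (norm_fst_le q).trans_lt (mem_ball_zero_iff.1 hqδ), (norm_snd_le q).trans_lt (mem_ball_zero_iff.1 hqδ), ?_⟩
  funext e
  -- both `U e · (τ e)⁻¹` and `(gaugeExp η · cfg τ A) e · (τ e)⁻¹` are chart points with the same log-coordinate
  obtain ⟨a₁, ha₁, hQa₁⟩ := hchart (gaugeTransform (gaugeExp r (q.1 : SiteFun r L)) (cfg r τ (q.2 : OneForm r L)) e *
    (τ e)⁻¹) (by rw [map_mul]; exact hq₁ e)
  obtain ⟨a₂, ha₂, hQa₂⟩ := hchart (U e * (τ e)⁻¹) (by rw [map_mul]; exact hU₁ e)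
  have hΓΛ : Γ q e = Λ U e := congrFun hqU e
  simp only [hΓ, hΦ, hΛ] at hΓΛ
  have ha : a₁ = a₂ := by
    rw [← hQa₁, ← hQa₂, map_mul, map_mul]
    exact hΓΛ
  have hg : U e * (τ e)⁻¹ =
      gaugeTransform (gaugeExp r (q.1 : SiteFun r L)) (cfg r τ (q.2 : OneForm r L)) e * (τ e)⁻¹ := by
    rw [← ha₂, ← ha₁, ha]
  exact mul_right_cancel hg

end Summit.QuantumFields.YangMills.Theorems.FemtoCurvatureTwoPointC

end
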